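import Summits.Ventures.LatticeQCDFlow.TrivializingMaps.ReweightingStepLaw

/-!
HONEST FRAMING: exact (Metropolis-corrected) sampling algorithms for lattice gauge theory; figures
of merit are autocorrelation/cost numbers at stated couplings and volumes; no continuum-physics
claim.

# AnnealingThermodynamicLength — A `k`-STEP EXACT REWEIGHTING SCHEDULE IN THE COUPLING COSTS AT LEAST
# `(DISCRETE THERMODYNAMIC LENGTH)² / k`; AT STRONG COUPLING THE NUMBER OF STEPS AT FIXED WEIGHT
# SECOND MOMENT IS LINEAR IN THE VOLUME (lean-2 GEN-8, ours)

Venture-side (OURS).  Cell `lqcd-flow` (pub-lqcd), unit `pub-lqcd-lean-2-g8`, 2026-08-22.  Sequel of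
`ReweightingStepLaw`: there, ONE exact reweighting step `β → β + δ` of any smooth action on `SU(n)^E` has
weight second moment `exp(Δ²ψ(β; δ))`, `Δ²ψ(β; δ) = ψ(β+2δ) − 2ψ(β+δ) + ψ(β) = ∫_β^{β+δ}∫_t^{t+δ} Var`,
`ψ = log Z`.  Here a SCHEDULE `β_0, β_1 = β_0 + δ_0, …, β_k = β_0 + Σ_{i<k} δ_i` (`δ_i ≥ 0`) is costed by
the sum of the per-step log second moments `Σ_{i<k} Δ²ψ(β_i; δ_i)` (for perfectly relaxed steps the
path-weight second moment is the product of the per-step ones — the equality case of the venture's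
T2-W / `Theory2.ess_perfect_relaxation`; this file is about the sum itself):

* §1 **`schedule_cost_ge_sum_sq`** — if `m_i ≤ Var_u(S∘ι)` on the `i`-th double step
  `[β_i, β_i + 2δ_i]`, then `Σ_i Δ²ψ(β_i; δ_i) ≥ Σ_i δ_i² m_i`;
  **`schedule_cost_ge_length_sq_div`** — Cauchy–Schwarz: `Σ_i δ_i² m_i ≥ (Σ_i δ_i √m_i)² / k` (`m_i ≥ 0`),
  so the cost of ANY `k`-step schedule is at least the square of its discrete thermodynamic length
  `Σ_i δ_i √m_i` over `k`;
* §2 **`schedule_cost_ge_uniform`** — with one floor `m ≤ Var` on `[β_0, β_k + max δ]`: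
  `Σ_i Δ²ψ ≥ m · (β_k − β_0)² / k`, i.e. **at most `exp(−c)` total log-cost needs
  `k ≥ m (β_k − β_0)² / c` steps**;
* §3 **`wilson_schedule_cost_ge_strongCoupling`** — `SU(n)` Wilson, `n ≥ 2`, every `L ≥ 2`, schedule
  inside the strong-coupling window of `StrongCouplingSpecificHeat` (`m = m₂(n)·#plaq/2`):
  `Σ_i Δ²ψ ≥ m₂(n) · #plaquettes · (β_k − β_0)² / (2k)` — the number of exact reweighting steps at
  fixed total weight second moment grows LINEARLY WITH THE VOLUME, closed-form rate, every volume.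

NOT CLAIMED: the identification of `Σ_i Δ²ψ` with a path effective sample size for imperfectly relaxed
layers (that is T2-W/T2-AC's hypothesis, finite-state in the tree); optimal schedules; anything outside
the strong-coupling window in §3; cost / autocorrelation / continuum statements.  Literature grade
(cell rule): known mechanism (thermodynamic length / Fisher-information cost of annealing, e.g.
Salamon–Berry 1983, Crooks 2007, Grosse–Maddison–Salakhutdinov 2013); new typing for the Wilson
setting, no new theorem of physics.
-/

noncomputable section

open MeasureTheory ProbabilityTheory Complex Metric Set Filter Topology Finset
open Literature.MathematicalPhysics.QuantumFieldTheory
open Literature.MathematicalPhysics.QuantumFieldTheory.Luscher2010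
open Literature.MathematicalPhysics.QuantumFieldTheory.WilsonFlow (coeConfig continuous_coeConfig)
open scoped Matrix Matrix.Norms.Frobenius ContDiff

namespace Summit.Ventures.LatticeQCDFlow.TrivializingMaps

/-! ## §1 The cost of a schedule dominates the squared discrete thermodynamic length over `k` -/

section Schedule

variable {d L n : ℕ} [NeZero L] {S : AmbConfig d L n → ℝ}

/-- **Per-step floors add up**: if `m_i ≤ Var_u(S∘ι)` for `u ∈ [β_i, β_i + 2δ_i]` (`δ_i ≥ 0`) then
`Σ_{i<k} Δ²ψ(β_i; δ_i) ≥ Σ_{i<k} δ_i² m_i` (`ψ = cgf(-S∘ι)`, any couplings `β_i`). [ours] -/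
theorem schedule_cost_ge_sum_sq (hS : ContDiff ℝ ∞ S) (k : ℕ) (β δ m : ℕ → ℝ)
    (hδ : ∀ i < k, 0 ≤ δ i)
    (hm : ∀ i < k, ∀ u ∈ Icc (β i) (β i + 2 * δ i), m i ≤ variance (fun U => S (coeConfig U))
      (boltzmannMeasure fun U : GaugeConfig d L (Matrix.specialUnitaryGroup (Fin n) ℂ) =>
        u * S (coeConfig U))) :
    ∑ i ∈ range k, δ i ^ 2 * m i ≤
      ∑ i ∈ range k,
        (cgf (fun U => -S (coeConfig U)) (trivialMeasure (Matrix.specialUnitaryGroup (Fin n) ℂ) d L)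
            (β i + 2 * δ i) -
          2 * cgf (fun U => -S (coeConfig U))
            (trivialMeasure (Matrix.specialUnitaryGroup (Fin n) ℂ) d L) (β i + δ i) +
          cgf (fun U => -S (coeConfig U))
            (trivialMeasure (Matrix.specialUnitaryGroup (Fin n) ℂ) d L) (β i)) :=
  sum_le_sum fun i hi =>
    cgf_second_difference_ge hS (hδ i (mem_range.1 hi)) (hm i (mem_range.1 hi))

/-- **Cauchy–Schwarz: `(Σ_{i<k} δ_i √m_i)² ≤ k · Σ_{i<k} δ_i² m_i`** (`m_i ≥ 0`): the squared discrete
thermodynamic length of a `k`-step schedule is at most `k` times its cost floor. [folklore] -/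
theorem length_sq_le_mul_sum_sq (k : ℕ) (δ m : ℕ → ℝ) (hm : ∀ i < k, 0 ≤ m i) :
    (∑ i ∈ range k, δ i * Real.sqrt (m i)) ^ 2 ≤ k * ∑ i ∈ range k, δ i ^ 2 * m i := by
  have h := sum_mul_sq_le_sq_mul_sq (range k) (fun _ => (1 : ℝ)) (fun i => δ i * Real.sqrt (m i))
  simp only [one_mul, one_pow, sum_const, card_range, nsmul_eq_mul, mul_one] at h
  refine h.trans (le_of_eq ?_)
  congr 1
  refine sum_congr rfl fun i hi => ?_
  rw [mul_pow, Real.sq_sqrt (hm i (mem_range.1 hi))]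

/-- **THE COST OF ANY `k`-STEP SCHEDULE IS AT LEAST (THERMODYNAMIC LENGTH)²/k**:
`Σ_{i<k} Δ²ψ(β_i; δ_i) ≥ (Σ_{i<k} δ_i √m_i)² / k` under per-step floors `0 ≤ m_i ≤ Var` (`k ≥ 1`).
[ours] -/
theorem schedule_cost_ge_length_sq_div (hS : ContDiff ℝ ∞ S) {k : ℕ} (hk : 1 ≤ k) (β δ m : ℕ → ℝ)
    (hδ : ∀ i < k, 0 ≤ δ i) (hm0 : ∀ i < k, 0 ≤ m i)
    (hm : ∀ i < k, ∀ u ∈ Icc (β i) (β i + 2 * δ i), m i ≤ variance (fun U => S (coeConfig U))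
      (boltzmannMeasure fun U : GaugeConfig d L (Matrix.specialUnitaryGroup (Fin n) ℂ) =>
        u * S (coeConfig U))) :
    (∑ i ∈ range k, δ i * Real.sqrt (m i)) ^ 2 / k ≤
      ∑ i ∈ range k,
        (cgf (fun U => -S (coeConfig U)) (trivialMeasure (Matrix.specialUnitaryGroup (Fin n) ℂ) d L)
            (β i + 2 * δ i) -
          2 * cgf (fun U => -S (coeConfig U))
            (trivialMeasure (Matrix.specialUnitaryGroup (Fin n) ℂ) d L) (β i + δ i) +
          cgf (fun U => -S (coeConfig U))
            (trivialMeasure (Matrix.specialUnitaryGroup (Fin n) ℂ) d L) (β i)) := by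
  have hk0 : (0 : ℝ) < k := by exact_mod_cast hk
  rw [div_le_iff₀ hk0]
  calc (∑ i ∈ range k, δ i * Real.sqrt (m i)) ^ 2 ≤ k * ∑ i ∈ range k, δ i ^ 2 * m i :=
        length_sq_le_mul_sum_sq k δ m hm0
    _ ≤ k * _ := mul_le_mul_of_nonneg_left (schedule_cost_ge_sum_sq hS k β δ m hδ hm) hk0.le
    _ = _ := mul_comm _ _

/-! ## §2 One uniform floor: `k ≥ m (β_k − β_0)² / cost` -/

/-- **UNIFORM FLOOR**: for the consecutive schedule `β_{i+1} = β_i + δ_i` (`δ_i ≥ 0`, `k ≥ 1` steps)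
with `m ≤ Var_u(S∘ι)` for all `u ∈ [β_0, β_k + D]`, `D ≥ δ_i` for all `i`:
`Σ_{i<k} Δ²ψ(β_i; δ_i) ≥ m · (β_k − β_0)² / k`. [ours] -/
theorem schedule_cost_ge_uniform (hS : ContDiff ℝ ∞ S) {k : ℕ} (hk : 1 ≤ k) (β δ : ℕ → ℝ)
    (hstep : ∀ i, β (i + 1) = β i + δ i) (hδ : ∀ i < k, 0 ≤ δ i) {D : ℝ} (hD : ∀ i < k, δ i ≤ D)
    {m : ℝ} (hm0 : 0 ≤ m)
    (hm : ∀ u ∈ Icc (β 0) (β k + D), m ≤ variance (fun U => S (coeConfig U))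
      (boltzmannMeasure fun U : GaugeConfig d L (Matrix.specialUnitaryGroup (Fin n) ℂ) =>
        u * S (coeConfig U))) :
    m * (β k - β 0) ^ 2 / k ≤
      ∑ i ∈ range k,
        (cgf (fun U => -S (coeConfig U)) (trivialMeasure (Matrix.specialUnitaryGroup (Fin n) ℂ) d L)
            (β i + 2 * δ i) -
          2 * cgf (fun U => -S (coeConfig U))
            (trivialMeasure (Matrix.specialUnitaryGroup (Fin n) ℂ) d L) (β i + δ i) +
          cgf (fun U => -S (coeConfig U))
            (trivialMeasure (Matrix.specialUnitaryGroup (Fin n) ℂ) d L) (β i)) := by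
  -- the couplings are monotone and `β_j = β_0 + Σ_{i<j} δ_i`
  have hsum : ∀ j, β j = β 0 + ∑ i ∈ range j, δ i := by
    intro j
    induction j with
    | zero => simp
    | succ j ih => rw [hstep, ih, sum_range_succ]; ring
  have hmono : ∀ j ≤ k, ∀ i ≤ j, β i ≤ β j := by
    intro j hj i hij
    rw [hsum i, hsum j, add_le_add_iff_left]
    exact sum_le_sum_of_subset_of_nonneg (range_subset_range.2 hij)
      fun l hl _ => hδ l (lt_of_lt_of_le (mem_range.1 hl) hj)
  -- each double step `[β_i, β_i + 2δ_i]` lies in `[β_0, β_k + D]`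
  have hwin : ∀ i < k, ∀ u ∈ Icc (β i) (β i + 2 * δ i), u ∈ Icc (β 0) (β k + D) := by
    intro i hi u hu
    refine ⟨(hmono i hi.le 0 (Nat.zero_le i)).trans hu.1, hu.2.trans ?_⟩
    have h1 : β i + δ i = β (i + 1) := (hstep i).symm
    have h2 : β (i + 1) ≤ β k := hmono k le_rfl (i + 1) hi
    linarith [hD i hi]
  have h := schedule_cost_ge_length_sq_div hS hk β δ (fun _ => m) hδ (fun _ _ => hm0)
    (fun i hi u hu => hm u (hwin i hi u hu))
  refine le_trans (le_of_eq ?_) h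
  have hlen : ∑ i ∈ range k, δ i * Real.sqrt m = (β k - β 0) * Real.sqrt m := by
    rw [← sum_mul, hsum k]; ring
  rw [hlen, mul_pow, Real.sq_sqrt hm0]
  ring

end Schedule

/-! ## §3 Wilson at strong coupling: the number of steps is linear in the volume -/

section Wilson

variable {d L n : ℕ} [NeZero L]

/-- **`SU(n)` WILSON, STRONG COUPLING, EVERY VOLUME `L ≥ 2`**: for a consecutive schedule
`β_{i+1} = β_i + δ_i` (`0 ≤ δ_i ≤ D`, `k ≥ 1`) with `[β_0, β_k + D]` inside the window
`|x| ≤ min (r/8) (m₂(n) r³/512)` of `StrongCouplingSpecificHeat`, the schedule cost satisfies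
`Σ_{i<k} Δ²ψ(β_i; δ_i) ≥ m₂(n) · #plaquettes · (β_k − β_0)² / (2k)`. [ours] -/
theorem wilson_schedule_cost_ge_strongCoupling (hn : 2 ≤ n) (hL : 2 ≤ L) {k : ℕ} (hk : 1 ≤ k)
    (β δ : ℕ → ℝ) (hstep : ∀ i, β (i + 1) = β i + δ i) (hδ : ∀ i < k, 0 ≤ δ i) {D : ℝ}
    (hD : ∀ i < k, δ i ≤ D)
    (hlo : -(min (1 / (8 * Real.exp 1 * (n : ℝ) * ((3 : ℝ) ^ d * (d : ℝ) ^ 2 + 1) ^ 2) / 8)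
      ((∫ g, ((g : Matrix (Fin n) (Fin n) ℂ)).trace.re ^ 2
          ∂(haarProbability (Matrix.specialUnitaryGroup (Fin n) ℂ))) *
        (1 / (8 * Real.exp 1 * (n : ℝ) * ((3 : ℝ) ^ d * (d : ℝ) ^ 2 + 1) ^ 2)) ^ 3 / 512)) ≤ β 0)
    (hhi : β k + D ≤ min (1 / (8 * Real.exp 1 * (n : ℝ) * ((3 : ℝ) ^ d * (d : ℝ) ^ 2 + 1) ^ 2) / 8)
      ((∫ g, ((g : Matrix (Fin n) (Fin n) ℂ)).trace.re ^ 2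
          ∂(haarProbability (Matrix.specialUnitaryGroup (Fin n) ℂ))) *
        (1 / (8 * Real.exp 1 * (n : ℝ) * ((3 : ℝ) ^ d * (d : ℝ) ^ 2 + 1) ^ 2)) ^ 3 / 512)) :
    (∫ g, ((g : Matrix (Fin n) (Fin n) ℂ)).trace.re ^ 2
        ∂(haarProbability (Matrix.specialUnitaryGroup (Fin n) ℂ))) * Fintype.card (Plaquette d L) *
        (β k - β 0) ^ 2 / (2 * k) ≤
      ∑ i ∈ range k,
        (cgf (fun U => -ambWilsonAction (coeConfig U))
            (trivialMeasure (Matrix.specialUnitaryGroup (Fin n) ℂ) d L) (β i + 2 * δ i) -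
          2 * cgf (fun U => -ambWilsonAction (coeConfig U))
            (trivialMeasure (Matrix.specialUnitaryGroup (Fin n) ℂ) d L) (β i + δ i) +
          cgf (fun U => -ambWilsonAction (coeConfig U))
            (trivialMeasure (Matrix.specialUnitaryGroup (Fin n) ℂ) d L) (β i)) := by
  set m₂ := ∫ g, ((g : Matrix (Fin n) (Fin n) ℂ)).trace.re ^ 2
    ∂(haarProbability (Matrix.specialUnitaryGroup (Fin n) ℂ)) with hm₂
  set P : ℝ := (Fintype.card (Plaquette d L) : ℝ) with hP
  have hm0 : 0 ≤ m₂ * P / 2 := by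
    have := haarSqReTrace_pos (n := n) (by omega)
    rw [← hm₂] at this
    positivity
  have h := schedule_cost_ge_uniform (d := d) (L := L) (n := n) contDiff_ambWilsonAction hk β δ
    hstep hδ hD hm0 (fun u hu => ?_)
  · refine le_trans (le_of_eq ?_) h
    field_simp
  -- the floor on the window, in Boltzmann form
  have hu' : |u| ≤ min (1 / (8 * Real.exp 1 * (n : ℝ) * ((3 : ℝ) ^ d * (d : ℝ) ^ 2 + 1) ^ 2) / 8)
      (m₂ * (1 / (8 * Real.exp 1 * (n : ℝ) * ((3 : ℝ) ^ d * (d : ℝ) ^ 2 + 1) ^ 2)) ^ 3 / 512) := by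
    rw [abs_le]
    exact ⟨by linarith [hu.1], by linarith [hu.2]⟩
  have hfloor := wilson_variance_ge_half_strongCoupling (d := d) (L := L) hn hL u hu'
  rw [← hm₂, ← hP] at hfloor
  have hV : variance (fun U => ambWilsonAction (coeConfig U))
      (boltzmannMeasure fun U : GaugeConfig d L (Matrix.specialUnitaryGroup (Fin n) ℂ) =>
        u * ambWilsonAction (coeConfig U)) =
      variance (wilsonAction (StrongCoupling.defRep n))
        (wilsonMeasure (d := d) (L := L) (StrongCoupling.defRep n) u) := by
    rw [StrongCoupling.boltzmannMeasure_smul_ambWilsonAction u]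
    simp_rw [StrongCoupling.ambWilsonAction_coeConfig]
  rw [hV]
  linarith

end Wilson

end Summit.Ventures.LatticeQCDFlow.TrivializingMaps
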